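import Summits.QuantumFields.BalabanUV.Beta.FP.GhostMixGammaTwoLeg
import Summits.QuantumFields.BalabanUV.Beta.FP.BondFamilyCovariance

/-!
# `Beta/FP/GhostMixPieceGamma` — road «FP» (binder row D1), row KER-γ (α2) sub-row **α2-c** «GHOST», PART 2b(iii): THE (MIX-1) GHOST PIECE OF THE JUNCTION — the
# windowed `(c, e)`-table of the Gamma word (direction-`c` averaging jet at `s`, direction-`e` jet at `s′`, the coarse two-point leg `𝔊` between the two root blocks and
# the fine two-point leg `Γ` between the two field points) as a DATA def, its joint `N`-block periodicity under DISPLAYED covariance letters, its majorant, entry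
# bound and LEDGER LINE by name over F′'s `FineSplitJunctionMajorant.rem_of_majorant` (p253277)

HONEST DEPENDENCY (page 1, mandatory): continuum YM on T⁴ ⇐ BetaPertH ∧ nine spine estimates (0/9 proved); BetaPertH ⇐ (D1) ∧ (D4) ∧
CAP+tail; G-an2-4 gates asym, D1 and NE2/3/4.  HONEST FRAMING (cell contract, verbatim): «discharging `BetaPertH` makes Bałaban's UV
stability UNCONDITIONAL — a real constructive-QFT result; it is NOT the continuum limit and NOT the Clay problem.»  THIS MODULE is [our object] bookkeeping (one
data def over ABSTRACT constituents — bond-letter family `(p, rad)`, coarse windows `U`, offsets `W`, legs `𝔊`, `Γ` — every road letter DISPLAYED: (radCov)(Ucov)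
(Gcov)(Γcov), (U)(W) at `R₀+1`, (G₀) sup, (Γ) profile at the window rate, the vertex-mass sup letter (Msup), the junction's (Kcov)(col)(J)(J′)) and [folklore]
plumbing BY NAME over `GhostMixGammaTwoLeg.abs_mix1_twoLeg_le_vertexMass` ∕ `windowedMajorant_mix1_twoLeg_le` ∕ `fieldWindowedMass_bond_le` (p254620),
`GhostMixTwoLeg.windowedMass_bond_le` (p253304), `BondFamilyCovariance.ker₁_bond_shift` (p254462) and F′.  It asserts nothing about Bałaban's constrained objects,
cites nothing, mints no `Prop` fact, 0 sorry.  NOT (H2), NOT the instances of `𝔊`∕`Γ` ((LEDGER-gh)), NOT hsplit, NOT D1, NOT BetaPertH, NOT continuum, NOT Clay.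

ABSOLUTE RULE (cell charter, verbatim): «No internally-minted statement may enter as a cited fact. Every hypothesis is either kernel-proved in this
package or a verbatim quotation of a PUBLISHED theorem with page reference. The manuscript(s) under audit are NOT citable for their own disputed
steps — they are the thing under adjudication; programme-internal (2001/route/tribunal) claims are never citable.»

CONTENT: §1 [our object] **`gmix1Piece`** + `gmix1Piece_apply`; §2 [folklore] **`isBlockPeriodic_gmix1Piece`**; §3 [folklore] **`kappa_gmix1Piece`**, **`bounded_gmix1Piece`**;
§4 [folklore] **`ledger_gmix1Piece`**.
Provenance: D1 formalisation swarm LEAF PROVER 05, unit `b2b-balaban-beta-d1-formalise-leaf-05` gen 15, 2026-08-21, road FP row KER-γ (α2) sub-row α2-c (owner GO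
R-FP-35 (a), words l.28227 «PART 2 THIS SHAPE», l.28436, l.28614; R-FP-36 (b)); «not in print; our bookkeeping»; no existing file touched.
-/

noncomputable section

namespace Summit.QuantumFields.BalabanUV.Beta.FP.GhostMixPieceGamma

open Finset Real
open scoped BigOperators
open Literature.MathematicalPhysics.QuantumFieldTheory.Balaban1983to89
open Literature.MathematicalPhysics.QuantumFieldTheory.Balaban1983to89.Beta
open ExpKernelCalculus (Site MKer shiftK)
open OneStepResolventKernel (Fib)
open OneStepKernelFamily (colH)
open DyadicShell (Pt supNorm)
open AxialBlockWeights (fineBlock)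
open Summit.QuantumFields.BalabanUV.Beta.D1BFx.MomentTransferPeriodic (IsBlockPeriodic)
open Summit.QuantumFields.BalabanUV.Beta.D1BFx.MomentTransferPeriodicEntry (EKer₂ dressedEntryP)
open Summit.QuantumFields.BalabanUV.Beta.FP.TransportInfinityM (colOf)
open Summit.QuantumFields.BalabanUV.Beta.FP.AveragingJetLettersRooted (ker₁)
open Summit.QuantumFields.BalabanUV.Beta.FP.ScalarAveragingJetLetters (sclW sclFld sclBg)
open Summit.QuantumFields.BalabanUV.Beta.FP.MixLoopPowerCounting (supNorm_cast_nonneg)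
open Summit.QuantumFields.BalabanUV.Beta.FP.GhostMixTwoLeg (windowedMass_bond_le)
open Summit.QuantumFields.BalabanUV.Beta.FP.GhostMixGammaTwoLeg (abs_mix1_twoLeg_le_vertexMass windowedMajorant_mix1_twoLeg_le fieldWindowedMass_bond_le)
open Summit.QuantumFields.BalabanUV.Beta.FP.FineSplitJunctionMajorant (rem_of_majorant)
open Summit.QuantumFields.BalabanUV.Beta.FP.BondFamilyCovariance (ker₁_bond_shift)

variable {σ : Type*} [Fintype σ]

/-! ## §1 The windowed (MIX-1) ghost piece -/

/-- [our object] **THE WINDOWED (MIX-1) GHOST PIECE** of the junction's near table: the `(c, e)` entry at `(s, s′)` is the Gamma word — the direction-`c` averaging jet of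
the bond-letter 0-form family at `s` (root block `u`), the direction-`e` jet at `s′` (root block `u′`), the coarse two-point leg `𝔊 u′ u` between the roots and the fine
two-point leg `Γ` between the two jets' field points — summed over `U s`, `U s′`, `W × W`, CUT OFF at `‖s′ − s‖∞ ≤ Nw`. -/
def gmix1Piece (N : ℕ) (p : σ → ℝ) (rad : σ → Pt → Pt → List (Pt × Fin 4)) (U : Pt → Finset Pt) (W : Finset Pt)
    (G Γ : Pt → Pt → ℝ) (Nw : ℕ) : EKer₂ 4 :=
  fun c e s s' => if supNorm (s' - s) ≤ Nw then
    ∑ u ∈ U s, ∑ u' ∈ U s', G u' u *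
      ∑ w ∈ W, ∑ w' ∈ W, ker₁ (sclW N p) (sclFld N u) (sclBg N u rad) (s, c) (s + w) * Γ (s + w) (s' + w') *
        ker₁ (sclW N p) (sclFld N u') (sclBg N u' rad) (s', e) (s' + w') else 0

/-- [our object] the piece, unfolded. -/
theorem gmix1Piece_apply (N : ℕ) (p : σ → ℝ) (rad : σ → Pt → Pt → List (Pt × Fin 4)) (U : Pt → Finset Pt) (W : Finset Pt)
    (G Γ : Pt → Pt → ℝ) (Nw : ℕ) (c e : Fin 4) (s s' : Pt) :
    gmix1Piece N p rad U W G Γ Nw c e s s' = if supNorm (s' - s) ≤ Nw then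
      ∑ u ∈ U s, ∑ u' ∈ U s', G u' u *
        ∑ w ∈ W, ∑ w' ∈ W, ker₁ (sclW N p) (sclFld N u) (sclBg N u rad) (s, c) (s + w) * Γ (s + w) (s' + w') *
          ker₁ (sclW N p) (sclFld N u') (sclBg N u' rad) (s', e) (s' + w') else 0 := rfl

/-! ## §2 The joint block periodicity of the piece -/

section Periodicity

variable {N : ℕ} {p : σ → ℝ} {rad : σ → Pt → Pt → List (Pt × Fin 4)}

/-- [folklore] **THE (MIX-1) GHOST PIECE IS JOINTLY `N`-BLOCK PERIODIC** (F′'s `hGper`) under (radCov), (Ucov), (Gcov) `𝔊 (u + t) (u′ + t) = 𝔊 u u′` and (Γcov)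
`Γ (x + N•t) (y + N•t) = Γ x y`. -/
theorem isBlockPeriodic_gmix1Piece
    (hradCov : ∀ (s : σ) (u t x' : Pt), rad s (u + t) x' = (rad s u x').map (fun ℓ => (ℓ.1 + (N : ℤ) • t, ℓ.2)))
    {U : Pt → Finset Pt} (hUcov : ∀ b t : Pt, U (b + (N : ℤ) • t) = (U b).image (· + t))
    {G : Pt → Pt → ℝ} (hGcov : ∀ u u' t : Pt, G (u + t) (u' + t) = G u u')
    {Γ : Pt → Pt → ℝ} (hΓcov : ∀ x y t : Pt, Γ (x + (N : ℤ) • t) (y + (N : ℤ) • t) = Γ x y)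
    (W : Finset Pt) (Nw : ℕ) (c e : Fin 4) :
    IsBlockPeriodic N (gmix1Piece N p rad U W G Γ Nw c e) := by
  classical
  intro t s s'
  simp only [gmix1Piece_apply]
  have ew : supNorm (s' + (N : ℤ) • t - (s + (N : ℤ) • t)) = supNorm (s' - s) := by rw [add_sub_add_right_eq_sub]
  rw [ew, hUcov s t, hUcov s' t, Finset.sum_image fun x _ y _ h => add_left_injective t h]
  refine if_congr Iff.rfl (Finset.sum_congr rfl fun u _ => ?_) rfl
  rw [Finset.sum_image fun x _ y _ h => add_left_injective t h]
  refine Finset.sum_congr rfl fun u' _ => ?_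
  rw [hGcov]
  congr 1
  refine Finset.sum_congr rfl fun w _ => Finset.sum_congr rfl fun w' _ => ?_
  have e1 : s + (N : ℤ) • t + w = s + w + (N : ℤ) • t := add_right_comm _ _ _
  have e2 : s' + (N : ℤ) • t + w' = s' + w' + (N : ℤ) • t := add_right_comm _ _ _
  rw [e1, e2, ker₁_bond_shift hradCov, ker₁_bond_shift hradCov, hΓcov]

end Periodicity

/-! ## §3 The majorant and the entry bound -/

section Shape

variable {N R₀ : ℕ} {p : σ → ℝ} {rad : σ → Pt → Pt → List (Pt × Fin 4)} {U : Pt → Finset Pt} {W : Finset Pt} {G Γ : Pt → Pt → ℝ} {C_G C_Γ δ : ℝ}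

/-- [folklore] **THE MAJORANT OF THE (MIX-1) GHOST PIECE** (F′'s (hk): `GhostMixGammaTwoLeg.abs_mix1_twoLeg_le_vertexMass` BY NAME; the cut-off only helps): under (G₀)
`|𝔊 u u′| ≤ C_G`, with `m_c(s,w) = Σ_{u∈U s}|ker₁^{(u)}(s,c)(s+w)|`:
`|gmix1Piece … c e s s′| ≤ C_G·Σ_{w,w′∈W}|Γ(s+w,s′+w′)|·m_c(s,w)·m_e(s′,w′)`. -/
theorem kappa_gmix1Piece (hG : ∀ u u', |G u u'| ≤ C_G) (Nw : ℕ) (c e : Fin 4) (s s' : Pt) :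
    |gmix1Piece N p rad U W G Γ Nw c e s s'|
      ≤ C_G * ∑ w ∈ W, ∑ w' ∈ W, |Γ (s + w) (s' + w')| *
          ((∑ u ∈ U s, |ker₁ (sclW N p) (sclFld N u) (sclBg N u rad) (s, c) (s + w)|) *
            (∑ u' ∈ U s', |ker₁ (sclW N p) (sclFld N u') (sclBg N u' rad) (s', e) (s' + w')|)) := by
  have hmain := abs_mix1_twoLeg_le_vertexMass (U := U) (W := W)
    (qd₁ := fun u b x => ker₁ (sclW N p) (sclFld N u) (sclBg N u rad) (b, c) x)
    (qd₂ := fun u b x => ker₁ (sclW N p) (sclFld N u) (sclBg N u rad) (b, e) x) (G := G) (Γ := Γ) hG s s'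
  rw [gmix1Piece_apply]
  split_ifs
  · exact hmain
  · rw [abs_zero]
    exact le_trans (abs_nonneg _) hmain

/-- [folklore] **ENTRY BOUND** (F′'s `hGb`): under (G₀), the (Γ) profile `|Γ c c′| ≤ C_Γ(‖c−c′‖∞+1)⁻²e^{−(δ∕N)‖c−c′‖∞}` (so `|Γ| ≤ C_Γ`) and the vertex-mass sup letter
(Msup) `Σ_{u∈U s}Σ_{w∈W}|ker₁^{(u)}(s,c)(s+w)| ≤ Msup`: every entry is bounded by `C_G·C_Γ·Msup²`. -/
theorem bounded_gmix1Piece (hδ : 0 ≤ δ) (hG : ∀ u u', |G u u'| ≤ C_G)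
    (hΓ : ∀ c c', |Γ c c'| ≤ C_Γ / ((supNorm (c - c') : ℝ) + 1) ^ 2 * Real.exp (-(δ / N) * (supNorm (c - c') : ℝ)))
    {Msup : ℝ} (hMsup : ∀ (c : Fin 4) (s : Pt), ∑ u ∈ U s, ∑ w ∈ W, |ker₁ (sclW N p) (sclFld N u) (sclBg N u rad) (s, c) (s + w)| ≤ Msup)
    (Nw : ℕ) (c e : Fin 4) :
    ∃ A, ∀ s s', |gmix1Piece N p rad U W G Γ Nw c e s s'| ≤ A := by
  have hCG : 0 ≤ C_G := (abs_nonneg _).trans (hG 0 0)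
  have hCΓ : 0 ≤ C_Γ := by
    have h := hΓ 0 0
    rw [sub_self, show supNorm (0 : Pt) = 0 from DyadicShell.supNorm_eq_zero_iff.mpr rfl] at h
    norm_num at h
    exact (abs_nonneg _).trans h
  -- the sup of the profile
  have hΓsup : ∀ c c', |Γ c c'| ≤ C_Γ := by
    intro c c'
    refine (hΓ c c').trans ?_
    have hr : (0 : ℝ) ≤ (supNorm (c - c') : ℝ) := supNorm_cast_nonneg _
    have h1 : (1 : ℝ) ≤ ((supNorm (c - c') : ℝ) + 1) ^ 2 := one_le_pow₀ (by linarith)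
    have h2 : Real.exp (-(δ / N) * (supNorm (c - c') : ℝ)) ≤ 1 := by
      apply Real.exp_le_one_iff.mpr
      have : 0 ≤ δ / N * (supNorm (c - c') : ℝ) := by positivity
      linarith
    calc C_Γ / ((supNorm (c - c') : ℝ) + 1) ^ 2 * Real.exp (-(δ / N) * (supNorm (c - c') : ℝ))
        ≤ C_Γ / ((supNorm (c - c') : ℝ) + 1) ^ 2 * 1 := mul_le_mul_of_nonneg_left h2 (by positivity)
      _ ≤ C_Γ * 1 := mul_le_mul_of_nonneg_right (div_le_self hCΓ h1) zero_le_one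
      _ = C_Γ := mul_one _
  set m₁ : Pt → Pt → ℝ := fun s w => ∑ u ∈ U s, |ker₁ (sclW N p) (sclFld N u) (sclBg N u rad) (s, c) (s + w)| with hm₁
  set m₂ : Pt → Pt → ℝ := fun s w => ∑ u ∈ U s, |ker₁ (sclW N p) (sclFld N u) (sclBg N u rad) (s, e) (s + w)| with hm₂
  have hm₁0 : ∀ s w, 0 ≤ m₁ s w := fun s w => Finset.sum_nonneg fun _ _ => abs_nonneg _
  have hm₂0 : ∀ s w, 0 ≤ m₂ s w := fun s w => Finset.sum_nonneg fun _ _ => abs_nonneg _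
  have hM₁ : ∀ s, ∑ w ∈ W, m₁ s w ≤ Msup := fun s => by rw [hm₁, Finset.sum_comm]; exact hMsup c s
  have hM₂ : ∀ s, ∑ w ∈ W, m₂ s w ≤ Msup := fun s => by rw [hm₂, Finset.sum_comm]; exact hMsup e s
  have hMsup0 : 0 ≤ Msup := (Finset.sum_nonneg fun w _ => hm₁0 0 w).trans (hM₁ 0)
  refine ⟨C_G * (C_Γ * (Msup * Msup)), fun s s' => ?_⟩
  calc |gmix1Piece N p rad U W G Γ Nw c e s s'|
      ≤ C_G * ∑ w ∈ W, ∑ w' ∈ W, |Γ (s + w) (s' + w')| * (m₁ s w * m₂ s' w') := kappa_gmix1Piece hG Nw c e s s'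
    _ ≤ C_G * ∑ w ∈ W, ∑ w' ∈ W, C_Γ * (m₁ s w * m₂ s' w') := by
        refine mul_le_mul_of_nonneg_left (Finset.sum_le_sum fun w _ => Finset.sum_le_sum fun w' _ =>
          mul_le_mul_of_nonneg_right (hΓsup _ _) (mul_nonneg (hm₁0 s w) (hm₂0 s' w'))) hCG
    _ = C_G * (C_Γ * ((∑ w ∈ W, m₁ s w) * (∑ w' ∈ W, m₂ s' w'))) := by
        congr 1
        rw [Finset.sum_mul_sum, Finset.mul_sum]
        refine Finset.sum_congr rfl fun w _ => ?_
        rw [Finset.mul_sum]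
    _ ≤ C_G * (C_Γ * (Msup * Msup)) := by
        refine mul_le_mul_of_nonneg_left (mul_le_mul_of_nonneg_left ?_ hCΓ) hCG
        exact mul_le_mul (hM₁ s) (hM₂ s') (Finset.sum_nonneg fun w _ => hm₂0 s' w) hMsup0

end Shape

/-! ## §4 The ledger line, by name over `FineSplitJunctionMajorant.rem_of_majorant` -/

section Ledger

variable {N : ℕ} {p : σ → ℝ} {rad : σ → Pt → Pt → List (Pt × Fin 4)} {ℓ₀ R₀ : ℕ} {U : Pt → Finset Pt} {W : Finset Pt}
  {G Γ : Pt → Pt → ℝ} {C_G C_Γ δ C_J C_J' : ℝ} {K : MKer (3 + 1) (Fib 3)} {a b : Fin 4}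

/-- **THE LEDGER LINE OF THE (MIX-1) GHOST PIECE** [folklore] (the `hLgh` binder for this piece): `K` block-covariant with absolutely summable END columns and the
column letters (J) (anchor `0`) ∕ (J′) at the window rate `δ`; the bond family's letters (`p ≥ 0`, length `≤ ℓ₀`, radius `R₀N`, (radCov)); (Ucov); (W) at `R₀+1`;
the legs' letters (G₀)(Gcov), (Γ)(Γcov); the vertex-mass sup letter (Msup) ⟹ for every finite coarse `S′`,
`Σ_{u∈S′}‖u‖∞²·|dressedEntryP (colH K N · 0 ·) (gmix1Piece N p rad U W 𝔊 Γ Nw) (N•(−u)) a b| ≤ 16·(3·C_J·C_J′·(1+16∕δ²)·(C_G·C_Γ(3+8(R₀+1)²)·Ã·A_M))`,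
`Ã = (ℓ₀N⁻⁴Σp)·(((1+80e^{δ∕4}(4∕δ)²)+(1+480e^{δ∕4}(4∕δ)⁴))·N²)`, `A_M = (ℓ₀Σp)e^{δR₀∕2}(e^{δ∕2}(1+480e^{δ∕4}(4∕δ)⁴))` (`rem_of_majorant`; (Mκ) at the anchor `0` :=
`windowedMajorant_mix1_twoLeg_le` with (M̃Γ) := `fieldWindowedMass_bond_le`, (M) := `windowedMass_bond_le` BY NAME). -/
theorem ledger_gmix1Piece (hδ : 0 < δ) (hN : 1 ≤ N)
    (hKcov : ∀ t : Fin (3 + 1) → ℤ, shiftK (-((N : ℤ) • t)) K = K)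
    (hcol : ∀ κ l : Fin 4, Summable fun x => |colOf K κ l x|)
    (hp : ∀ s, 0 ≤ p s) (hrad : ∀ s u x', (rad s u x').length ≤ ℓ₀)
    (hradR : ∀ (s : σ) (u : Pt) (x : ↥(fineBlock N)) (ℓ : Pt × Fin 4), ℓ ∈ rad s u x.1 → supNorm (ℓ.1 - (N : ℤ) • u) ≤ R₀ * N)
    (hradCov : ∀ (s : σ) (u t x' : Pt), rad s (u + t) x' = (rad s u x').map (fun ℓ => (ℓ.1 + (N : ℤ) • t, ℓ.2)))
    (hUcov : ∀ b t : Pt, U (b + (N : ℤ) • t) = (U b).image (· + t))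
    (hW : ∀ w ∈ W, supNorm w ≤ (R₀ + 1) * N)
    (hG : ∀ u u', |G u u'| ≤ C_G) (hGcov : ∀ u u' t : Pt, G (u + t) (u' + t) = G u u')
    (hΓ : ∀ c c', |Γ c c'| ≤ C_Γ / ((supNorm (c - c') : ℝ) + 1) ^ 2 * Real.exp (-(δ / N) * (supNorm (c - c') : ℝ)))
    (hΓcov : ∀ x y t : Pt, Γ (x + (N : ℤ) • t) (y + (N : ℤ) • t) = Γ x y)
    {Msup : ℝ} (hMsup : ∀ (c : Fin 4) (s : Pt), ∑ u ∈ U s, ∑ w ∈ W, |ker₁ (sclW N p) (sclFld N u) (sclBg N u rad) (s, c) (s + w)| ≤ Msup)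
    (hJ : ∀ (c : Fin 4) (q : Pt), |colH K N a 0 c q| ≤ C_J * Real.exp (-(δ / N) * (supNorm (q - (N : ℤ) • (0 : Pt)) : ℝ)))
    (hJ' : ∀ (e : Fin 4) (S' : Finset Pt) (x : Pt), ∑ u ∈ S', (1 + ((supNorm (x - (N : ℤ) • u) : ℝ) / N) ^ 2) * |colH K N b u e x| ≤ C_J')
    (Nw : ℕ) :
    ∀ S' : Finset Pt, ∑ u ∈ S', (supNorm u : ℝ) ^ 2 *
        |dressedEntryP (fun c a' => colH K N a' 0 c) (gmix1Piece N p rad U W G Γ Nw) ((N : ℤ) • (-u)) a b|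
      ≤ 16 * (3 * C_J * C_J' * (1 + 16 / δ ^ 2) *
          (C_G * (C_Γ * (3 + 8 * ((R₀ : ℝ) + 1) ^ 2)) *
              ((((ℓ₀ : ℕ) : ℝ) * (((N : ℝ) ^ 4)⁻¹ * ∑ s, p s)) *
                (((1 + 80 * Real.exp (δ / 4) * (4 / δ) ^ 2) + (1 + 480 * Real.exp (δ / 4) * (4 / δ) ^ 4)) * (N : ℝ) ^ 2)) *
              ((((ℓ₀ : ℕ) : ℝ) * ∑ s, p s) * Real.exp (δ * R₀ / 2) *
                (Real.exp (δ / 2) * (1 + 480 * Real.exp (δ / 4) * (4 / δ) ^ 4))))) := by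
  -- (Mκ) at the anchor `0`
  have hAκ : ∀ (c e : Fin 4) (A : Finset Pt),
      ∑ q ∈ A, ∑ x ∈ A, Real.exp (-(δ / (2 * N)) * (supNorm (q - (N : ℤ) • (0 : Pt)) : ℝ)) * (1 + ((supNorm (x - q) : ℝ) / N) ^ 2) *
        (C_G * ∑ w ∈ W, ∑ w' ∈ W, |Γ (q + w) (x + w')| *
          ((∑ u ∈ U q, |ker₁ (sclW N p) (sclFld N u) (sclBg N u rad) (q, c) (q + w)|) *
            (∑ u' ∈ U x, |ker₁ (sclW N p) (sclFld N u') (sclBg N u' rad) (x, e) (x + w')|)))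
        ≤ C_G * (C_Γ * (3 + 8 * ((R₀ : ℝ) + 1) ^ 2)) *
              ((((ℓ₀ : ℕ) : ℝ) * (((N : ℝ) ^ 4)⁻¹ * ∑ s, p s)) *
                (((1 + 80 * Real.exp (δ / 4) * (4 / δ) ^ 2) + (1 + 480 * Real.exp (δ / 4) * (4 / δ) ^ 4)) * (N : ℝ) ^ 2)) *
              ((((ℓ₀ : ℕ) : ℝ) * ∑ s, p s) * Real.exp (δ * R₀ / 2) *
                (Real.exp (δ / 2) * (1 + 480 * Real.exp (δ / 4) * (4 / δ) ^ 4))) := by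
    intro c e A
    have hMt := fun q : Pt => fieldWindowedMass_bond_le hδ hN hp hrad U W A e q
    have hM := windowedMass_bond_le hδ hN hp hrad hradR U W A c ((N : ℤ) • (0 : Pt))
    have h := windowedMajorant_mix1_twoLeg_le (n := N) (R := R₀ + 1) (U := U) (W := W)
      (qd₁ := fun u b x => ker₁ (sclW N p) (sclFld N u) (sclBg N u rad) (b, c) x)
      (qd₂ := fun u b x => ker₁ (sclW N p) (sclFld N u) (sclBg N u rad) (b, e) x) hδ hN hW hG hΓ A (0 : Pt) hMt hM
    have e1 : (((R₀ + 1 : ℕ) : ℝ)) = (R₀ : ℝ) + 1 := by push_cast; ring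
    rw [e1] at h
    exact h
  exact rem_of_majorant (G := gmix1Piece N p rad U W G Γ Nw) hδ hN hKcov hcol
    (fun c e => isBlockPeriodic_gmix1Piece hradCov hUcov hGcov hΓcov W Nw c e)
    (fun c e => bounded_gmix1Piece hδ.le hG hΓ hMsup Nw c e)
    (fun c e s s' => kappa_gmix1Piece hG Nw c e s s') hAκ hJ hJ'

end Ledger

end Summit.QuantumFields.BalabanUV.Beta.FP.GhostMixPieceGamma

end
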